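import Mathlib
import HarnessLib
import Summits.Ventures.LatticeQCDFlow.Exactness.SUNResidualGeneratorDivergence

/-!
# Divergence of the inverse-isotopy generator link by link, and the trace bookkeeping for Jacobi's formula on the `SU(N)` residual layer

HONEST FRAMING: exact (Metropolis-corrected) sampling algorithms for lattice gauge theory;
figures of merit are autocorrelation/cost numbers at stated couplings and volumes; no
continuum-physics claim.

Venture `LatticeQCDFlow` (cell pub-lqcd), topic `Exactness`; FANOUT row 10 (`eng-equiv`: `equiv/residual.py`,
`flows_jax/residual_flow.py` — residual / stout / stout-defect layers and their closed-form per-link log-det).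
NEW WORK of the cell; no definition (local notations only); nothing cited as a fact.  Series "the residual
layer's exact Jacobian IS the closed form" (8 files: `SUNJacobianTraceAlgebra`, `SUNResidualTangentDerivative`,
`SUNResidualTangentTimeDerivative`, `SUNResidualGeneratorDivergence`, `SUNResidualJacobiTrace`,
`SUNResidualJacobiIdentity`, `SUNResidualJacobiFlow`, `SUNResidualLayerJacobianDet`), continuing gen-11's
`SUNResidualLayerVelocity` … `SUNResidualLayerJacobian` (existence of a continuous positive exact Jacobian).

File 5 of the series (local notations as before).
* `linkDeriv_coord_generator`, **`linkDiv_generator_eq`** — Lüscher's divergence of `Z_s` is the sum over ACTIVE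
  links `a` and basis elements `b` of `(∂_{single a (T^b U_a)} Z_a)^b`;
* `residualTangentOp_inverse_apply_left`, `residualTangentOp_inverse_suProj_comm`;
* **`sum_coord_inverse_suProj_commutator`** — `∑_b (Top⁻¹ 𝒫 (A·Top T^b − Top T^b·A))^b = 0` for every `A`
  (`= tr(Top⁻¹ (𝒫 ad_A 𝒫) Top) = tr(𝒫 ad_A 𝒫) = 0`);
* `suProj_fderiv_exponent`, `suProj_fderiv_residualTangentBlock_apply` — tangent link derivatives of
  `𝔰𝔲(n)`-valued data stay in `𝔰𝔲(n)`; `residualTangentOp_zero` — `Top[0, U, a] = 1`.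

Printed counterparts, NAMED ONLY: Lüscher, CMP 293 (2010) 899, §3 eqs. (3.4)–(3.9); Abbott et al.,
arXiv:2305.02402 §4.2; Morningstar–Peardon, PRD 69 (2004) 054501; Abel–Jacobi–Liouville (tree:
`Literature.Analysis.ODE.LiouvilleFormula`).
-/

noncomputable section

namespace Summit.Ventures.LatticeQCDFlow.Exactness

open Literature.MathematicalPhysics.QuantumFieldTheory
open Literature.MathematicalPhysics.QuantumFieldTheory.Luscher2010
open Literature.MathematicalPhysics.QuantumFieldTheory.WilsonFlow
open Summit.Ventures.LatticeQCDFlow.TrivializingMaps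
open Filter Set
open scoped Matrix Matrix.Norms.Frobenius Topology ContDiff

variable {d L n : ℕ} [NeZero L]

section TraceIdentity

variable (p : Edge d L → Prop) [DecidablePred p]
  (Q : {e : Edge d L // p e} → ({f : Edge d L // ¬p f} → Matrix.specialUnitaryGroup (Fin n) ℂ) →
    Matrix (Fin n) (Fin n) ℂ → Matrix (Fin n) (Fin n) ℂ)
  (κ : {e : Edge d L // p e} → ({f : Edge d L // ¬p f} → Matrix.specialUnitaryGroup (Fin n) ℂ) → ℝ)
  (Qamb : {e : Edge d L // p e} → AmbConfig d L n → Matrix (Fin n) (Fin n) ℂ)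

set_option quotPrecheck false in
/-- The residual isotopy at time `τ` (local notation, as in `SUNResidualIsotopy`). -/
local notation "famb[" τ "]" => (fun (W : AmbConfig d L n) (e : Edge d L) =>
  if h : p e then NormedSpace.exp ((τ : ℝ) • Qamb ⟨e, h⟩ W) * W e else W e)

set_option quotPrecheck false in
/-- The block of the tangential operator (local notation, as in `SUNResidualTangentOperator`). -/
local notation "Blk[" τ ", " W ", " a "]" =>
  ((fderiv ℝ (fun Y : Matrix (Fin n) (Fin n) ℂ => Y * ((famb[τ]) W a)ᴴ) 0).comp
    ((fderiv ℝ (fun W' : AmbConfig d L n => W' a) 0).comp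
      ((fderiv ℝ (famb[τ]) W).comp
        ((fderiv ℝ (fun Y : Matrix (Fin n) (Fin n) ℂ => (Pi.single a Y : AmbConfig d L n)) 0).comp
          (fderiv ℝ (fun Y : Matrix (Fin n) (Fin n) ℂ => Y * W a) 0)))))

set_option quotPrecheck false in
/-- The tangential operator (local notation, as in `SUNResidualTangentOperator`). -/
local notation "Top[" τ ", " W ", " a "]" =>
  ((fderiv ℝ (suProj (n := n)) 0).comp ((Blk[τ, W, a]).comp (fderiv ℝ (suProj (n := n)) 0)) +
    (ContinuousLinearMap.id ℝ (Matrix (Fin n) (Fin n) ℂ) - fderiv ℝ (suProj (n := n)) 0))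

/-! ## The divergence of the generator, link by link -/

/-- The `b`-coordinate of a link derivative of the generator is the coordinate of an `fderiv`. -/
theorem linkDeriv_coord_generator (B : SuBasis n) {Z : ℝ → AmbConfig d L n → AmbConfig d L n}
    (hZ1 : ContDiff ℝ 1 (fun q : ℝ × AmbConfig d L n => Z q.1 q.2)) (s : ℝ) (W₀ : AmbConfig d L n)
    (e : Edge d L) (b : B.ι) :
    linkDeriv e (B.T b) (fun W' => B.coord b (Z s W' e)) W₀ =
      B.coord b (fderiv ℝ (fun W : AmbConfig d L n => Z s W e) W₀ (Pi.single e (B.T b * W₀ e))) := by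
  -- `coord b` as a continuous linear functional
  let φ : Matrix (Fin n) (Fin n) ℂ →ₗ[ℝ] ℝ :=
    { toFun := B.coord b
      map_add' := suBasis_coord_add B b
      map_smul' := fun r X => by rw [suBasis_coord_smul, RingHom.id_apply, smul_eq_mul] }
  let φL : Matrix (Fin n) (Fin n) ℂ →L[ℝ] ℝ := LinearMap.toContinuousLinearMap φ
  have hφ : ∀ X, φL X = B.coord b X := fun X => rfl
  have hZd : DifferentiableAt ℝ (fun W : AmbConfig d L n => Z s W e) W₀ := by
    have h1 : ContDiff ℝ 1 (fun W : AmbConfig d L n => Z s W e) :=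
      (contDiff_eval e).comp (hZ1.comp ((contDiff_const (c := s)).prodMk contDiff_id))
    exact (h1.differentiable (by norm_num)).differentiableAt
  have hcomp : HasFDerivAt (fun W' : AmbConfig d L n => B.coord b (Z s W' e))
      (φL.comp (fderiv ℝ (fun W : AmbConfig d L n => Z s W e) W₀)) W₀ :=
    φL.hasFDerivAt.comp W₀ hZd.hasFDerivAt
  rw [linkDeriv_eq_fderiv hcomp.differentiableAt, hcomp.fderiv]
  rfl

/-- **The divergence of the generator is a sum over ACTIVE links** of the coordinates of its one-link
derivatives (the generator vanishes identically on frozen links). -/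
theorem linkDiv_generator_eq (B : SuBasis n) {Z : ℝ → AmbConfig d L n → AmbConfig d L n}
    (hZ1 : ContDiff ℝ 1 (fun q : ℝ × AmbConfig d L n => Z q.1 q.2))
    (hZ0 : ∀ (s : ℝ) (W : AmbConfig d L n) (e : Edge d L), ¬p e → Z s W e = 0)
    (s : ℝ) (W₀ : AmbConfig d L n) :
    linkDiv B (Z s) W₀ = ∑ a : {e : Edge d L // p e}, ∑ b,
      B.coord b (fderiv ℝ (fun W : AmbConfig d L n => Z s W a.1) W₀ (Pi.single a.1 (B.T b * W₀ a.1))) := by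
  unfold linkDiv
  simp_rw [linkDeriv_coord_generator B hZ1]
  rw [← Fintype.sum_subtype_add_sum_subtype p (fun e : Edge d L => ∑ b,
    B.coord b (fderiv ℝ (fun W : AmbConfig d L n => Z s W e) W₀ (Pi.single e (B.T b * W₀ e))))]
  have hfro : ∑ f : {e : Edge d L // ¬p e}, ∑ b,
      B.coord b (fderiv ℝ (fun W : AmbConfig d L n => Z s W f.1) W₀ (Pi.single f.1 (B.T b * W₀ f.1))) = 0 := by
    refine Finset.sum_eq_zero fun f _ => Finset.sum_eq_zero fun b _ => ?_
    have hz : (fun W : AmbConfig d L n => Z s W f.1) = fun _ => 0 := funext fun W => hZ0 s W f.1 f.2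
    rw [hz, (hasFDerivAt_const (0 : Matrix (Fin n) (Fin n) ℂ) W₀).fderiv, zero_apply]
    exact suBasis_coord_zero B b
  rw [hfro, add_zero]

/-! ## The inverse tangential operator -/

omit [NeZero L] in
/-- **Left inverse on units**: `Top⁻¹ (Top x) = x`. -/
theorem residualTangentOp_inverse_apply_left (τ : ℝ) (W : AmbConfig d L n) (a : Edge d L)
    (hT : IsUnit (Top[τ, W, a])) (x : Matrix (Fin n) (Fin n) ℂ) :
    ContinuousLinearMap.inverse (Top[τ, W, a]) ((Top[τ, W, a]) x) = x := by
  set e := ContinuousLinearEquiv.unitsEquiv ℝ (Matrix (Fin n) (Fin n) ℂ) hT.unit with he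
  have hecoe : (e : Matrix (Fin n) (Fin n) ℂ →L[ℝ] Matrix (Fin n) (Fin n) ℂ) = Top[τ, W, a] := by
    ext x
    rfl
  rw [← hecoe, ContinuousLinearMap.inverse_equiv]
  exact e.symm_apply_apply x

omit [NeZero L] in
/-- **`Top⁻¹` commutes with `𝒫`** (because `Top` does). -/
theorem residualTangentOp_inverse_suProj_comm (τ : ℝ) (W : AmbConfig d L n) (a : Edge d L)
    (hT : IsUnit (Top[τ, W, a])) (y : Matrix (Fin n) (Fin n) ℂ) :
    ContinuousLinearMap.inverse (Top[τ, W, a]) (suProj y) =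
      suProj (ContinuousLinearMap.inverse (Top[τ, W, a]) y) := by
  set x := ContinuousLinearMap.inverse (Top[τ, W, a]) y with hx
  have hTx : (Top[τ, W, a]) x = y := residualTangentOp_inverse_apply p Qamb τ W a hT y
  have h1 : (Top[τ, W, a]) (suProj x) = suProj y := by
    rw [residualTangentOp_suProj_comm, hTx]
  rw [← h1, residualTangentOp_inverse_apply_left p Qamb τ W a hT]

/-! ## Commutator terms have no trace -/

omit [NeZero L] in
/-- **The vanishing sums of Jacobi's formula.**  At any `(τ, W)` with `Top` a unit, for every matrix `A`
and every orthonormal basis `(T^b)` of `𝔰𝔲(n)`: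
`∑_b (Top⁻¹ 𝒫 (A · Top T^b − Top T^b · A))^b = 0` — this is `tr(Top⁻¹ (𝒫 ad_A 𝒫) Top) = tr(𝒫 ad_A 𝒫) = 0`. -/
theorem sum_coord_inverse_suProj_commutator (B : SuBasis n) (τ : ℝ) (W : AmbConfig d L n) (a : Edge d L)
    (hT : IsUnit (Top[τ, W, a])) (A : Matrix (Fin n) (Fin n) ℂ) :
    ∑ b, B.coord b (ContinuousLinearMap.inverse (Top[τ, W, a])
      (suProj (A * (Top[τ, W, a]) (B.T b) - (Top[τ, W, a]) (B.T b) * A))) = 0 := by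
  set T := Top[τ, W, a] with hTdef
  set Ti := ContinuousLinearMap.inverse T with hTi
  set P : Matrix (Fin n) (Fin n) ℂ →L[ℝ] Matrix (Fin n) (Fin n) ℂ := fderiv ℝ (suProj (n := n)) 0 with hP
  have hPapp : ∀ X, P X = suProj X := fun X => fderiv_suProj_apply 0 X
  -- the compressed commutator operator
  have had : HasFDerivAt (fun Y : Matrix (Fin n) (Fin n) ℂ => A * Y - Y * A)
      (((ContinuousLinearMap.mul ℝ (Matrix (Fin n) (Fin n) ℂ)) A) -
        ((ContinuousLinearMap.mul ℝ (Matrix (Fin n) (Fin n) ℂ)).flip A)) 0 :=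
    ((ContinuousLinearMap.mul ℝ (Matrix (Fin n) (Fin n) ℂ)) A).hasFDerivAt.sub
      ((ContinuousLinearMap.mul ℝ (Matrix (Fin n) (Fin n) ℂ)).flip A).hasFDerivAt
  set ad : Matrix (Fin n) (Fin n) ℂ →L[ℝ] Matrix (Fin n) (Fin n) ℂ :=
    fderiv ℝ (fun Y : Matrix (Fin n) (Fin n) ℂ => A * Y - Y * A) 0 with hadDef
  have hadapp : ∀ Y, ad Y = A * Y - Y * A := by
    intro Y
    have h2 : fderiv ℝ (fun Y : Matrix (Fin n) (Fin n) ℂ => A * Y - Y * A) 0 =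
        ((ContinuousLinearMap.mul ℝ (Matrix (Fin n) (Fin n) ℂ)) A) -
          ((ContinuousLinearMap.mul ℝ (Matrix (Fin n) (Fin n) ℂ)).flip A) := had.fderiv
    rw [hadDef, h2]
    rfl
  -- the operator whose compressed trace is the sum
  set Lop : Matrix (Fin n) (Fin n) ℂ →L[ℝ] Matrix (Fin n) (Fin n) ℂ := Ti.comp (P.comp (ad.comp T)) with hLop
  have hsum : ∑ b, B.coord b (Ti (suProj (A * T (B.T b) - T (B.T b) * A))) = ∑ b, B.coord b (Lop (B.T b)) := by
    refine Finset.sum_congr rfl fun b _ => ?_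
    rw [hLop]
    change _ = B.coord b (Ti (P (ad (T (B.T b)))))
    rw [hPapp, hadapp]
  rw [hsum, ← trace_suProj_comp_comp_suProj B Lop]
  -- pointwise commutation facts
  have hPT : ∀ x, T (P x) = P (T x) := fun x => by
    rw [hPapp, hPapp, hTdef]
    exact residualTangentOp_suProj_comm p Qamb τ W a x
  have hPTi : ∀ y, Ti (P y) = P (Ti y) := fun y => by
    rw [hPapp, hPapp, hTi, hTdef]
    exact residualTangentOp_inverse_suProj_comm p Qamb τ W a hT y
  have hPP : ∀ x, P (P x) = P x := fun x => by rw [hPapp, hPapp, suProj_suProj]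
  have hTTi : ∀ y, T (Ti y) = y := fun y => by
    rw [hTi, hTdef]
    exact residualTangentOp_inverse_apply p Qamb τ W a hT y
  -- `𝒫 Lop 𝒫 = Ti ∘ (𝒫 ad 𝒫) ∘ T`
  have hconj : ((P.comp (Lop.comp P) : Matrix (Fin n) (Fin n) ℂ →L[ℝ] Matrix (Fin n) (Fin n) ℂ) :
      Matrix (Fin n) (Fin n) ℂ →ₗ[ℝ] Matrix (Fin n) (Fin n) ℂ) =
      (Ti : Matrix (Fin n) (Fin n) ℂ →ₗ[ℝ] Matrix (Fin n) (Fin n) ℂ) ∘ₗ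
        ((((P.comp (ad.comp P) : Matrix (Fin n) (Fin n) ℂ →L[ℝ] Matrix (Fin n) (Fin n) ℂ) :
          Matrix (Fin n) (Fin n) ℂ →ₗ[ℝ] Matrix (Fin n) (Fin n) ℂ)) ∘ₗ
          (T : Matrix (Fin n) (Fin n) ℂ →ₗ[ℝ] Matrix (Fin n) (Fin n) ℂ)) := by
    apply LinearMap.ext
    intro x
    change P (Lop (P x)) = Ti (P (ad (P (T x))))
    rw [hLop]
    change P (Ti (P (ad (T (P x))))) = Ti (P (ad (P (T x))))
    rw [hPT, ← hPTi, hPP]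
  -- `tr(Ti X T) = tr(X)`
  have htrace : LinearMap.trace ℝ _ ((Ti : Matrix (Fin n) (Fin n) ℂ →ₗ[ℝ] Matrix (Fin n) (Fin n) ℂ) ∘ₗ
      ((((P.comp (ad.comp P) : Matrix (Fin n) (Fin n) ℂ →L[ℝ] Matrix (Fin n) (Fin n) ℂ) :
          Matrix (Fin n) (Fin n) ℂ →ₗ[ℝ] Matrix (Fin n) (Fin n) ℂ)) ∘ₗ
          (T : Matrix (Fin n) (Fin n) ℂ →ₗ[ℝ] Matrix (Fin n) (Fin n) ℂ))) =
      LinearMap.trace ℝ _ (((P.comp (ad.comp P) : Matrix (Fin n) (Fin n) ℂ →L[ℝ] Matrix (Fin n) (Fin n) ℂ) :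
          Matrix (Fin n) (Fin n) ℂ →ₗ[ℝ] Matrix (Fin n) (Fin n) ℂ)) := by
    have hTTi' : (T : Matrix (Fin n) (Fin n) ℂ →ₗ[ℝ] Matrix (Fin n) (Fin n) ℂ) ∘ₗ
        (Ti : Matrix (Fin n) (Fin n) ℂ →ₗ[ℝ] Matrix (Fin n) (Fin n) ℂ) = LinearMap.id := by
      apply LinearMap.ext
      intro y
      exact hTTi y
    rw [LinearMap.trace_comp_comm', LinearMap.comp_assoc, hTTi', LinearMap.comp_id]
  rw [hconj, htrace]
  exact trace_suProj_ad_suProj B A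

/-! ## Link derivatives of `𝔰𝔲(n)`-valued data stay in `𝔰𝔲(n)` -/

omit [DecidablePred p] in
/-- The link derivative of the realised exponent along `𝔰𝔲(n)` lies in `𝔰𝔲(n)`. -/
theorem suProj_fderiv_exponent (hQ2 : ∀ a, ContDiff ℝ 2 (Qamb a))
    (hQ : ∀ a y, ∀ U ∈ Matrix.specialUnitaryGroup (Fin n) ℂ, (Q a y U)ᴴ = -Q a y U ∧ (Q a y U).trace = 0)
    (hQambQ : ∀ a (U : GaugeConfig d L (Matrix.specialUnitaryGroup (Fin n) ℂ)),
      Qamb a (coeConfig U) = Q a (fun f => U f) (U a.1 : Matrix (Fin n) (Fin n) ℂ))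
    (U : GaugeConfig d L (Matrix.specialUnitaryGroup (Fin n) ℂ)) (a' : {e : Edge d L // p e}) (e : Edge d L)
    {X : Matrix (Fin n) (Fin n) ℂ} (hX : Xᴴ = -X) (hX0 : X.trace = 0) :
    suProj (fderiv ℝ (Qamb a') (coeConfig U) (Pi.single e (X * (U e : Matrix (Fin n) (Fin n) ℂ)))) =
      fderiv ℝ (Qamb a') (coeConfig U) (Pi.single e (X * (U e : Matrix (Fin n) (Fin n) ℂ))) := by
  have hγmem : ∀ r : ℝ, NormedSpace.exp (r • X) * (U e : Matrix (Fin n) (Fin n) ℂ) ∈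
      Matrix.specialUnitaryGroup (Fin n) ℂ := exp_smul_mul_mem_specialUnitaryGroup (U e).2 hX hX0
  have hQd : DifferentiableAt ℝ (Qamb a') (coeConfig U) :=
    (((hQ2 a').differentiable (by norm_num)).differentiableAt)
  have hc : HasDerivAt (fun r : ℝ => Qamb a' (Function.update (coeConfig U) e
      (NormedSpace.exp (r • X) * (U e : Matrix (Fin n) (Fin n) ℂ))))
      (fderiv ℝ (Qamb a') (coeConfig U) (Pi.single e (X * (U e : Matrix (Fin n) (Fin n) ℂ)))) 0 := by
    have h := hasDerivAt_update_exp_smul (coeConfig U) e X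
    rw [coeConfig_apply] at h
    exact hQd.hasFDerivAt.comp_hasDerivAt_of_eq (0 : ℝ) h
      (by rw [zero_smul, NormedSpace.exp_zero, one_mul]; exact (Function.update_eq_self e (coeConfig U)).symm)
  -- along the curve the exponent lies in `𝔰𝔲(n)`
  have hsu : ∀ r : ℝ, suProj (Qamb a' (Function.update (coeConfig U) e
      (NormedSpace.exp (r • X) * (U e : Matrix (Fin n) (Fin n) ℂ)))) =
      Qamb a' (Function.update (coeConfig U) e (NormedSpace.exp (r • X) * (U e : Matrix (Fin n) (Fin n) ℂ))) := by
    intro r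
    rw [update_coeConfig_eq U e ⟨_, hγmem r⟩, hQambQ]
    obtain ⟨h1, h2⟩ := hQ a' _ _ (Function.update U e ⟨_, hγmem r⟩ a'.1).2
    exact suProj_eq_self h1 h2
  have hP : HasFDerivAt (suProj (n := n)) (fderiv ℝ (suProj (n := n)) 0) (Qamb a' (coeConfig U)) := by
    have hd : DifferentiableAt ℝ (suProj (n := n)) (Qamb a' (coeConfig U)) :=
      ((contDiff_suProj (m := 1)).differentiable (by norm_num)).differentiableAt
    have heq : fderiv ℝ (suProj (n := n)) (Qamb a' (coeConfig U)) = fderiv ℝ (suProj (n := n)) 0 := by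
      ext Y
      rw [fderiv_suProj_apply, fderiv_suProj_apply]
    rw [← heq]
    exact hd.hasFDerivAt
  have h0 : Qamb a' (Function.update (coeConfig U) e (NormedSpace.exp ((0 : ℝ) • X) * (U e : Matrix (Fin n) (Fin n) ℂ)))
      = Qamb a' (coeConfig U) := by
    rw [zero_smul, NormedSpace.exp_zero, one_mul]
    exact congrArg (Qamb a') (Function.update_eq_self e (coeConfig U))
  have hcomp := hP.comp_hasDerivAt_of_eq (0 : ℝ) hc h0.symm
  have hcomp' := hcomp.congr_of_eventuallyEq (Filter.Eventually.of_forall fun r => (hsu r).symm)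
  have huniq := hcomp'.unique hc
  exact (fderiv_suProj_apply 0 _).symm.trans huniq

/-- The link derivative of `W ↦ Blk[τ, W, a] ζ` (`ζ ∈ 𝔰𝔲(n)` fixed) along `𝔰𝔲(n)` at the active link `a`
lies in `𝔰𝔲(n)`. -/
theorem suProj_fderiv_residualTangentBlock_apply (hQ2 : ∀ a, ContDiff ℝ 2 (Qamb a))
    (hQ : ∀ a y, ∀ U ∈ Matrix.specialUnitaryGroup (Fin n) ℂ, (Q a y U)ᴴ = -Q a y U ∧ (Q a y U).trace = 0)
    (hlip : ∀ a y, ∀ U ∈ Matrix.specialUnitaryGroup (Fin n) ℂ, ∀ V ∈ Matrix.specialUnitaryGroup (Fin n) ℂ,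
      frobNorm (Q a y U - Q a y V) ≤ κ a y * frobNorm (U - V))
    (hQambQ : ∀ a (U : GaugeConfig d L (Matrix.specialUnitaryGroup (Fin n) ℂ)),
      Qamb a (coeConfig U) = Q a (fun f => U f) (U a.1 : Matrix (Fin n) (Fin n) ℂ))
    (τ : ℝ) (U : GaugeConfig d L (Matrix.specialUnitaryGroup (Fin n) ℂ)) {a : Edge d L} (ha : p a) (e : Edge d L)
    {X ζ : Matrix (Fin n) (Fin n) ℂ} (hX : Xᴴ = -X) (hX0 : X.trace = 0) (hζ : ζᴴ = -ζ) (hζ0 : ζ.trace = 0) :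
    suProj (fderiv ℝ (fun W' : AmbConfig d L n => (Blk[τ, W', a]) ζ) (coeConfig U)
        (Pi.single e (X * (U e : Matrix (Fin n) (Fin n) ℂ)))) =
      fderiv ℝ (fun W' : AmbConfig d L n => (Blk[τ, W', a]) ζ) (coeConfig U)
        (Pi.single e (X * (U e : Matrix (Fin n) (Fin n) ℂ))) := by
  have hγmem : ∀ r : ℝ, NormedSpace.exp (r • X) * (U e : Matrix (Fin n) (Fin n) ℂ) ∈
      Matrix.specialUnitaryGroup (Fin n) ℂ := exp_smul_mul_mem_specialUnitaryGroup (U e).2 hX hX0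
  have hgd : DifferentiableAt ℝ (fun W' : AmbConfig d L n => (Blk[τ, W', a]) ζ) (coeConfig U) :=
    ((contDiff_residualTangentBlock_apply_right p Qamb hQ2 τ a ζ).differentiable (by norm_num)).differentiableAt
  have h0 : Function.update (coeConfig U) e (NormedSpace.exp ((0 : ℝ) • X) * (U e : Matrix (Fin n) (Fin n) ℂ))
      = coeConfig U := by
    rw [zero_smul, NormedSpace.exp_zero, one_mul]
    exact Function.update_eq_self e (coeConfig U)
  have hc : HasDerivAt (fun r : ℝ => (Blk[τ, Function.update (coeConfig U) e
      (NormedSpace.exp (r • X) * (U e : Matrix (Fin n) (Fin n) ℂ)), a]) ζ)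
      (fderiv ℝ (fun W' : AmbConfig d L n => (Blk[τ, W', a]) ζ) (coeConfig U)
        (Pi.single e (X * (U e : Matrix (Fin n) (Fin n) ℂ)))) 0 := by
    have h := hasDerivAt_update_exp_smul (coeConfig U) e X
    rw [coeConfig_apply] at h
    exact hgd.hasFDerivAt.comp_hasDerivAt_of_eq (0 : ℝ) h h0.symm
  have hsu : ∀ r : ℝ, suProj ((Blk[τ, Function.update (coeConfig U) e
      (NormedSpace.exp (r • X) * (U e : Matrix (Fin n) (Fin n) ℂ)), a]) ζ) =
      (Blk[τ, Function.update (coeConfig U) e (NormedSpace.exp (r • X) * (U e : Matrix (Fin n) (Fin n) ℂ)), a]) ζ := by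
    intro r
    rw [update_coeConfig_eq U e ⟨_, hγmem r⟩]
    exact suProj_residualTangentBlock p Q κ Qamb hQ2 hQ hlip hQambQ τ _ ha hζ hζ0
  have hP : HasFDerivAt (suProj (n := n)) (fderiv ℝ (suProj (n := n)) 0) ((Blk[τ, coeConfig U, a]) ζ) := by
    have hd : DifferentiableAt ℝ (suProj (n := n)) ((Blk[τ, coeConfig U, a]) ζ) :=
      ((contDiff_suProj (m := 1)).differentiable (by norm_num)).differentiableAt
    have heq : fderiv ℝ (suProj (n := n)) ((Blk[τ, coeConfig U, a]) ζ) = fderiv ℝ (suProj (n := n)) 0 := by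
      ext Y
      rw [fderiv_suProj_apply, fderiv_suProj_apply]
    rw [← heq]
    exact hd.hasFDerivAt
  have hval0 : (Blk[τ, Function.update (coeConfig U) e
      (NormedSpace.exp ((0 : ℝ) • X) * (U e : Matrix (Fin n) (Fin n) ℂ)), a]) ζ = (Blk[τ, coeConfig U, a]) ζ := by
    rw [h0]
  have hcomp := hP.comp_hasDerivAt_of_eq (0 : ℝ) hc hval0.symm
  have hcomp' := hcomp.congr_of_eventuallyEq (Filter.Eventually.of_forall fun r => (hsu r).symm)
  have huniq := hcomp'.unique hc
  exact (fderiv_suProj_apply 0 _).symm.trans huniq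

/-! ## The tangential operator at time `0` is the identity -/

omit [NeZero L] in
/-- At `τ = 0` the isotopy is the identity, so `Top[0, U, a] = 1` at every `SU(n)^E` configuration. -/
theorem residualTangentOp_zero (U : GaugeConfig d L (Matrix.specialUnitaryGroup (Fin n) ℂ)) (a : Edge d L) :
    (Top[(0 : ℝ), coeConfig U, a]) = ContinuousLinearMap.id ℝ (Matrix (Fin n) (Fin n) ℂ) := by
  have hid : (famb[(0 : ℝ)]) = id := funext fun W => residualIsotopy_zero p Qamb W
  have hUU : (U a : Matrix (Fin n) (Fin n) ℂ) * (U a : Matrix (Fin n) (Fin n) ℂ)ᴴ = 1 := by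
    have h := Matrix.mem_unitaryGroup_iff.mp (Matrix.mem_specialUnitaryGroup_iff.mp (U a).2).1
    simpa only [Matrix.star_eq_conjTranspose] using h
  ext v
  rw [residualTangentOp_apply, ContinuousLinearMap.id_apply]
  have h1 : fderiv ℝ (famb[(0 : ℝ)]) (coeConfig U) = ContinuousLinearMap.id ℝ (AmbConfig d L n) := by
    rw [hid]
    exact fderiv_id
  have h2 : (famb[(0 : ℝ)]) (coeConfig U) a = (U a : Matrix (Fin n) (Fin n) ℂ) := by
    rw [hid, id, coeConfig_apply]
  rw [h1, h2, ContinuousLinearMap.id_apply, coeConfig_apply, Pi.single_eq_same, Matrix.mul_assoc, hUU,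
    Matrix.mul_one, suProj_suProj, add_sub_cancel]

end TraceIdentity

end Summit.Ventures.LatticeQCDFlow.Exactness

end
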